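import Summits.QuantumFields.YangMills.Theorems.BalabanUVNodesN07DbarFrameStepBridge
import Summits.QuantumFields.YangMills.Theorems.UnitScaleTiltProp8ChartDoubleBarAccumulated
import Summits.QuantumFields.YangMills.Theorems.UnitScaleTiltProp8ChartLocalityFlat
import Literature.MathematicalPhysics.QuantumFieldTheory.Balaban1983to89.Node00.ShearedAveragingFlat
import HarnessLib

/-!
# N07 [B11] — (L1″) THE FRAME-TOWER BRIDGE, ABSTRACT FORM: UST's ACCUMULATED double-bar frames `V_l` of a fine field `X` ([3] (97)∕(110) with the joint `eml` over `Idx P`)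
# equal print's (85) sheared factors `S_l = shearRIter av symCd (loopAvgBlockOp expMeanLogSU) U₁` (the (0.11) averaged contour datum) up to the recursively defined `φ_l`,
# on any family of «good» sites closed under passing to the block — by induction on the level with (G3) `N07DbarFrameStepBridge.norm_frameStep_sub_shearStep_le`

Cell `pub-ymgap`, seat `pub-ymgap-dag-n07-e` g28 (LANE OWNER of the K0 road chart side), work file for ⚑ LOCATED-NRM-ROW-CURRENCY option ρ3 (desk memo `WORD-NRM-ROW-CURRENCY.md` §§5–8).
`--kind proof --supports stmt-QuantumFields-20541 --as helper`; count-neutral; 0 sorry.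

WHAT IS PROVED: ★★★ `norm_accFrame_sub_shearRIter_le` — for a fine field `X : T_η-bonds → ((Matrix (Fin N) (Fin N) ℂ))ˣ`, a fine `SU(N)` configuration `U₁` with averaging tower `M^i U₁ = Averaging.iter av i U₁`, UST's
accumulated frames `V` (`V 0 = 1`, `V (i+1) y = V i ȳ·vframeU(U̿^{(i)}X) y`, unitary on good sites), the DICTIONARY `Ū^{(i)}_{eml}X = (M^iU₁)♮` on the block bonds of good sites, per-level
letters `p i`, `t i` (Federbush-small stair families of `M^iU₁` with relative deviation `p i`; print's sheared family within `t i < δ_SU` of `1`) and a budget `φ` with `0 ≤ φ 0` and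
`φ i + 64(t i+φ i)² + (1+φ i)(270000·p i·(p i+2t i+3φ i)³ + 4(p i)²(2t i+3φ i)) ≤ φ (i+1)`, `p i ≤ 1∕24`, `2·t i + 3·φ i ≤ 1∕24` below `l`:  `‖V_i(z) − S_i(z)‖ ≤ φ i` at every
good site of every level `i ≤ l`.  HONEST SCOPE: the letters, the dictionary, unitarity and goodness are HYPOTHESES (discharged at the record by the (L1″) instantiation file, to follow);
nothing of [15]∕[6] proved; K0⁷ NOT closed; N07 NOT discharged; counts unmoved; nothing continuum ∕ OS ∕ Clay.  No `def`, no `instance`, no `sorry`.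

References: [Balaban1985Averaging] (78) p. 30, (85) p. 31, (92) p. 31, (97)–(100) p. 32, (110) p. 34; [Balaban1987RG1] (0.4)–(0.11) p. 253.
-/

set_option autoImplicit false

noncomputable section

open scoped BigOperators Matrix.Norms.L2Operator
open NormedSpace

namespace Summit.QuantumFields.YangMills.BalabanUVNodes.N07DbarFrameTowerBridge

open Literature.MathematicalPhysics.QuantumFieldTheory.Balaban1983to89
open Literature.MathematicalPhysics.QuantumFieldTheory.Balaban1983to89.Node00
open MatrixLog ExpMeanLog FederbushMean
open B10Eq27TorusAxialLog (gaugeActT gaugeActT_apply unitsField toUField)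
open Summit.QuantumFields.YangMills.Theorems.Prop8Chart (emlIterU)
open Summit.QuantumFields.YangMills.Theorems.Prop8ChartDoubleBar (vframeU dbarIterU dbarIterU_eq_gaugeActT_emlIterU vframeU_congr)
open Summit.QuantumFields.YangMills.BalabanUVNodes.N07SymContourData (stairFamily symContourData)
open Summit.QuantumFields.YangMills.BalabanUVNodes.N07DbarFrameStepBridge (norm_frameStep_sub_shearStep_le)

variable {P : Params} {N : ℕ} [NeZero N]


/-- ★★★ **(L1″, ABSTRACT) — UST's accumulated double-bar frames against print's (85) sheared factors at the (0.11) datum, by induction on the level.**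
[cite: Balaban1985Averaging, (85) p.31, (92) p.31, (97)–(100) p.32, (110) p.34; Balaban1987RG1, (0.10)–(0.11) p.253] -/
theorem norm_accFrame_sub_shearRIter_le (av : ∀ i, Averaging P i (Matrix.specialUnitaryGroup (Fin N) ℂ)) (U₁ : GaugeField P 0 (Matrix.specialUnitaryGroup (Fin N) ℂ)) (X : GaugeField P 0 ((Matrix (Fin N) (Fin N) ℂ))ˣ)
    (V : (i : ℕ) → Site P i → ((Matrix (Fin N) (Fin N) ℂ))ˣ) (hV0 : ∀ x, V 0 x = 1)
    (hVs : ∀ (i : ℕ) (y : Site P (i + 1)), V (i + 1) y = V i (emb y) * vframeU (dbarIterU i X) y)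
    (good : (i : ℕ) → Site P i → Prop) (l : ℕ) (hl : l ≤ P.m + P.K)
    (hgood_emb : ∀ i, i < l → ∀ y : Site P (i + 1), good (i + 1) y → good i (emb y))
    (hgood_block : ∀ i, i < l → ∀ y : Site P (i + 1), good (i + 1) y → ∀ r : Fin P.d → Fin P.L, good i (Site.blockSite y r))
    (hVu : ∀ i, i ≤ l → ∀ z, good i z → ((V i z : ((Matrix (Fin N) (Fin N) ℂ))ˣ) : (Matrix (Fin N) (Fin N) ℂ)) ∈ Matrix.unitaryGroup (Fin N) ℂ)
    (hdict : ∀ i, i < l → ∀ y : Site P (i + 1), good (i + 1) y → ∀ b : PBond P i, blockOf b.src = y → blockOf b.tgt = y →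
      emlIterU i X b = unitsField (toUField (Averaging.iter av i U₁)) b)
    (p t φ : ℕ → ℝ) (hφ0 : 0 ≤ φ 0)
    (hφs : ∀ i, i < l → φ i + 64 * (t i + φ i) ^ 2 + (1 + φ i) * (270000 * p i * (p i + (2 * t i + 3 * φ i)) ^ 3 + 4 * p i ^ 2 * (2 * t i + 3 * φ i)) ≤ φ (i + 1))
    (hp : ∀ i, i < l → p i ≤ 1 / 24) (htφ : ∀ i, i < l → 2 * t i + 3 * φ i ≤ 1 / 24) (htδ : ∀ i, i < l → t i < deltaSU (Fin N))
    (hfam : ∀ i, i < l → ∀ y : Site P (i + 1), good (i + 1) y → ∀ r : Fin P.d → Fin P.L,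
      FamilySmall (federbushSU (n := Fin N)).δ (stairFamily (Averaging.iter av i U₁) y r))
    (hP : ∀ i, i < l → ∀ y : Site P (i + 1), good (i + 1) y → ∀ (r : Fin P.d → Fin P.L) (k : Fin ((Nat.factorial P.d - 1) + 1)),
      ‖((stairFamily (Averaging.iter av i U₁) y r k : (Matrix.specialUnitaryGroup (Fin N) ℂ)) : (Matrix (Fin N) (Fin N) ℂ)) *
          star (((federbushSU (n := Fin N)).M (stairFamily (Averaging.iter av i U₁) y r) : (Matrix.specialUnitaryGroup (Fin N) ℂ)) : (Matrix (Fin N) (Fin N) ℂ)) - 1‖ ≤ p i)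
    (hY : ∀ i, i < l → ∀ y : Site P (i + 1), good (i + 1) y → ∀ r : Fin P.d → Fin P.L,
      ‖((((shearRIter av (fun _ => symContourData (federbushSU (n := Fin N))) (loopAvgBlockOp expMeanLogSU) U₁ i (emb y))⁻¹ *
            (symContourData (federbushSU (n := Fin N))).holTo (Averaging.iter av i U₁) y (Site.blockSite y r) *
            shearRIter av (fun _ => symContourData (federbushSU (n := Fin N))) (loopAvgBlockOp expMeanLogSU) U₁ i (Site.blockSite y r) : (Matrix.specialUnitaryGroup (Fin N) ℂ))) : (Matrix (Fin N) (Fin N) ℂ)) - 1‖ ≤ t i) :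
    ∀ i, i ≤ l → ∀ z : Site P i, good i z →
      ‖((V i z : ((Matrix (Fin N) (Fin N) ℂ))ˣ) : (Matrix (Fin N) (Fin N) ℂ)) - ((shearRIter av (fun _ => symContourData (federbushSU (n := Fin N))) (loopAvgBlockOp expMeanLogSU) U₁ i z : (Matrix.specialUnitaryGroup (Fin N) ℂ)) : (Matrix (Fin N) (Fin N) ℂ))‖ ≤ φ i := by
  intro i
  induction i with
  | zero =>
    intro _ z _
    rw [hV0]
    show ‖((1 : ((Matrix (Fin N) (Fin N) ℂ))ˣ) : (Matrix (Fin N) (Fin N) ℂ)) - (((1 : (Matrix.specialUnitaryGroup (Fin N) ℂ))) : (Matrix (Fin N) (Fin N) ℂ))‖ ≤ φ 0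
    rw [Units.val_one, OneMemClass.coe_one, sub_self, norm_zero]
    exact hφ0
  | succ i ih =>
    intro hi1 y hy
    have hi : i < l := Nat.lt_of_succ_le hi1
    have hiK : i + 1 ≤ P.m + P.K := hi1.trans hl
    -- UST: `V (i+1) y = V i ȳ · vframeU((M^iU₁)♮^{V_i⁻¹}) y` by (92) and block-locality of the frame with the dictionary
    have h92 := dbarIterU_eq_gaugeActT_emlIterU X V hV0 hVs i
    have hloc : vframeU (dbarIterU i X) y = vframeU (gaugeActT (fun z => (V i z)⁻¹) (unitsField (toUField (Averaging.iter av i U₁)))) y := by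
      rw [h92]
      refine vframeU_congr hiK y fun b hb1 hb2 => ?_
      rw [gaugeActT_apply, gaugeActT_apply, hdict i hi y hy b hb1 hb2]
    rw [hVs i y, hloc]
    -- print: the successor clause of `shearRIter` is definitional
    show ‖((V i (emb y) * vframeU (gaugeActT (fun z => (V i z)⁻¹) (unitsField (toUField (Averaging.iter av i U₁)))) y : ((Matrix (Fin N) (Fin N) ℂ))ˣ) : (Matrix (Fin N) (Fin N) ℂ)) -
        ((shearRIter av (fun _ => symContourData (federbushSU (n := Fin N))) (loopAvgBlockOp expMeanLogSU) U₁ i (emb y) *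
            loopAvgBlockOp expMeanLogSU i y (fun x =>
              (shearRIter av (fun _ => symContourData (federbushSU (n := Fin N))) (loopAvgBlockOp expMeanLogSU) U₁ i (emb y))⁻¹ *
                (symContourData (federbushSU (n := Fin N))).holTo (Averaging.iter av i U₁) y x *
                shearRIter av (fun _ => symContourData (federbushSU (n := Fin N))) (loopAvgBlockOp expMeanLogSU) U₁ i x) : (Matrix.specialUnitaryGroup (Fin N) ℂ)) : (Matrix (Fin N) (Fin N) ℂ))‖ ≤ φ (i + 1)
    refine le_trans ?_ (hφs i hi)
    exact norm_frameStep_sub_shearStep_le hiK (Averaging.iter av i U₁) (V i)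
      (shearRIter av (fun _ => symContourData (federbushSU (n := Fin N))) (loopAvgBlockOp expMeanLogSU) U₁ i) y
      (hVu i hi.le (emb y) (hgood_emb i hi y hy)) (ih hi.le (emb y) (hgood_emb i hi y hy)) (fun r => ih hi.le _ (hgood_block i hi y hy r))
      (hfam i hi y hy) (hP i hi y hy) (hY i hi y hy) (htδ i hi) (hp i hi) (htφ i hi)

end Summit.QuantumFields.YangMills.BalabanUVNodes.N07DbarFrameTowerBridge

end
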